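import Literature.MathematicalPhysics.KineticTheory.InfiniteChainL2Locality
import Literature.MathematicalPhysics.KineticTheory.InfiniteChainL2LocalityPolynomialTools
import HarnessLib

/-!
# Fixed-time `L²` locality of the Buttà–Marchioro flow with a POLYNOMIAL HORIZON

Topic `Literature/MathematicalPhysics/KineticTheory` (companion of `InfiniteChainL2Locality`). The theorem
`InfiniteChainDynamics.exists_summable_l2_locality` gives, for every time window `τ`, a summable rate `ε` for the
`L²(μ)` distance between `a ∘ φ_t` (`|t| ≤ τ`) and its severed approximant `a ∘ T^{Λ_{0,n}}_t`. Here the SAME proof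
is re-run with its constants kept (`exists_weighted_l2_locality`): the rate is `(1+n)²`-summable and its weighted
sum grows at most polynomially in the window, `Σ_n (1+n)² ε_n ≤ A_tot (1+τ)^9`. This is the quantitative light cone
behind the Abel-weighted temperedness of space–time correlations (the `(1+x²)`-weighted clustering transfer turns it
into `Σ_x (1+x²)|Cov(a, (a∘φ_t)∘τ_x)| ≤ A′(1+|t|)^9`).

Bookkeeping (Buttà–Marchioro 2016 §3 with the thresholds of `InfiniteChainL2LocalityTools`): with
`c(τ) = A(1+τ²(1+τ)) ≤ A(1+τ)³` the good regime starts at the EXPLICIT threshold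
`n₀(τ) = ⌈12 + 2A + 2c + 2c(C_ω+3/2)/λ₀ + 2τK⌉₊ = O((1+τ)³)` (the condition `δ_n ≤ 1` holds there by
`lightCone_threshold_decay_le_one`), where the rate is `Cb(τ) n^{2d+1}32^{−n} + C_η ρ(τ)ⁿ` with `Cb(τ)` linear in
`τ` and `ρ(τ) = e^{−λ₀/(8c(τ))}`, `(1−ρ)^{−3} ≤ (1 + 8c/λ₀)³`; before it the trivial bound `2‖a‖₂`.
Everything is proved; tagged `[folklore]` / cited to BM 2016. No definitions, no named facts.
-/

noncomputable section

open MeasureTheory Filter Set Function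
open scoped Topology ENNReal

namespace Literature.MathematicalPhysics.KineticTheory.HeatConduction

namespace InfiniteChainDynamics

open OscillatorChain

variable {P : OscillatorChain} {s₁ s₂ : ℕ} (D : InfiniteChainDynamics P)

/-- The scale `c(τ) = A(1+τ²(1+τ))` is at most `A(1+τ)³`. [folklore] -/
theorem scale_le_cube {A τ : ℝ} (hA : 0 ≤ A) (hτ : 0 ≤ τ) : A * (1 + τ ^ 2 * (1 + τ)) ≤ A * (1 + τ) ^ 3 := by
  refine mul_le_mul_of_nonneg_left ?_ hA
  nlinarith [sq_nonneg τ]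

/-- The explicit threshold is cubic in the window: with `c ≤ A(1+τ)³`,
`13 + 2A + 2c + 2c·Cl + 2τK ≤ (13 + 4A + 2A·Cl + 2K)(1+τ)³`. [folklore] -/
theorem threshold_le_cube {A K Cl c τ : ℝ} (hA : 0 ≤ A) (hK : 0 ≤ K) (hCl : 0 ≤ Cl) (hτ : 0 ≤ τ)
    (hcτ : c ≤ A * (1 + τ) ^ 3) :
    13 + 2 * A + 2 * c + 2 * c * Cl + 2 * τ * K ≤ (13 + 4 * A + 2 * A * Cl + 2 * K) * (1 + τ) ^ 3 := by
  have hY : (1 : ℝ) ≤ (1 + τ) ^ 3 := one_le_pow₀ (by linarith)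
  have hτY : τ ≤ (1 + τ) ^ 3 := by nlinarith [sq_nonneg τ]
  have e1 : 2 * c * Cl ≤ 2 * (A * (1 + τ) ^ 3) * Cl :=
    mul_le_mul_of_nonneg_right (by linarith) hCl
  have e2 : 2 * τ * K ≤ 2 * (1 + τ) ^ 3 * K := mul_le_mul_of_nonneg_right (by linarith) hK
  have e3 : (13 + 2 * A) * 1 ≤ (13 + 2 * A) * (1 + τ) ^ 3 := mul_le_mul_of_nonneg_left hY (by positivity)
  nlinarith [e1, e2, e3]

/-- `2 + 22τK ≤ (2 + 22K)(1+τ)⁹` for `τ, K ≥ 0`. [folklore] -/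
theorem lin_window_le_pow_nine {K τ : ℝ} (hK : 0 ≤ K) (hτ : 0 ≤ τ) :
    2 + 22 * τ * K ≤ (2 + 22 * K) * (1 + τ) ^ 9 := by
  have h1 : (1 : ℝ) ≤ 1 + τ := by linarith
  have hY : (1 : ℝ) ≤ (1 + τ) ^ 9 := one_le_pow₀ h1
  have hτY : τ ≤ (1 + τ) ^ 9 := (by linarith : τ ≤ 1 + τ).trans (le_self_pow₀ h1 (by norm_num))
  have e1 : 22 * τ * K ≤ 22 * (1 + τ) ^ 9 * K := mul_le_mul_of_nonneg_right (by linarith) hK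
  nlinarith [e1]

/-- `1 + 8c/λ ≤ (1 + 8A/λ)(1+τ)³` when `c ≤ A(1+τ)³`, `λ > 0`. [folklore] -/
theorem ratio_window_le_cube {A c lam τ : ℝ} (hA : 0 ≤ A) (hlam : 0 < lam) (hτ : 0 ≤ τ)
    (hcτ : c ≤ A * (1 + τ) ^ 3) : 1 + 8 * c / lam ≤ (1 + 8 * A / lam) * (1 + τ) ^ 3 := by
  have hY : (1 : ℝ) ≤ (1 + τ) ^ 3 := one_le_pow₀ (by linarith)
  have e1 : 8 * c / lam ≤ 8 * A / lam * (1 + τ) ^ 3 := by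
    rw [div_mul_eq_mul_div, div_le_div_iff_of_pos_right hlam]
    nlinarith
  have e2 : 0 ≤ 8 * A / lam := by positivity
  nlinarith [e1, e2]

/-- **Fixed-time `L²` locality of a `𝒳₀`-dynamics with a polynomial horizon.** Let `U`, `V` be even non-negative
polynomials of degrees `2s₁, 2s₂ ≥ 2`, `D` a dynamics with carrier `𝒳₀`, `μ` a state with BM's superstability
estimate (2.3) preserved by `D` and by every severed flow `T^{Λ_{0,n}}_t`; let `a` be measurable, depending on the
sites `-1, 0, 1`, with `a⁴ ∈ L¹(μ)`, `a ∈ L²(μ)`, and polynomially Lipschitz in the coordinates at `-1, 0, 1`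
(hypothesis `ha`). Then there are `A_tot` and `m` (`= 9`) such that for every `τ ≥ 0` there is a rate `ε ≥ 0` with
`Σ_n (1+n)² ε_n ≤ A_tot (1+τ)^m` such that for all `|t| ≤ τ` and `n ∈ ℕ` the local approximant
`g = a ∘ T^{Λ_{0,n}}_t` (depending on the sites of `[-n-1, n+1]`, measurable, in `L²(μ)`) satisfies
`(∫ (a ∘ φ_t - g)² dμ)^{1/2} ≤ ε_n`. [cite: ButtaMarchioro2016, §3 eqs. (3.7), (3.14)–(3.16) and §2 eq. (2.6)] -/
theorem exists_weighted_l2_locality (hs₁ : 1 ≤ s₁) (hs₂ : 1 ≤ s₂)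
    (hU1 : IsEvenPolyOfDegree P.U s₁) (hV1 : IsEvenPolyOfDegree P.V s₂)
    (hcar : D.carrier = P.bmGood) (hB1 : P.CondB1) {μ : Measure ChainConfig}
    (hss : P.HasSuperstabilityEstimate μ) (hD : D.PreservesMeasure μ)
    (hsev : ∀ (n : ℕ) (t : ℝ),
      MeasurePreserving (severedFlow hB1 (Finset.Icc ((0 : ℤ) - n) ((0 : ℤ) + n)) t) μ μ)
    {a : ChainConfig → ℝ} (ham : Measurable a) (had : DependsOn a (Icc (-1 : ℤ) 1))
    (ha2 : MemLp a 2 μ) (ha4 : Integrable (fun σ => a σ ^ 4) μ) {Ca : ℝ} {da : ℕ} (hCa : 0 ≤ Ca)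
    (ha : ∀ (σ σ' : ChainConfig) (R δ : ℝ), 1 ≤ R → 0 ≤ δ → δ ≤ 1 →
      (∀ i : ℤ, -1 ≤ i → i ≤ 1 → |(σ' i).1| ≤ R ∧ |(σ' i).2| ≤ R ∧
        |(σ i).1 - (σ' i).1| ≤ δ ∧ |(σ i).2 - (σ' i).2| ≤ δ) → |a σ - a σ'| ≤ Ca * R ^ da * δ) :
    ∃ (Atot : ℝ) (m : ℕ), ∀ τ : ℝ, 0 ≤ τ → ∃ ε : ℕ → ℝ, (∀ n, 0 ≤ ε n) ∧
      Summable (fun n : ℕ => (1 + (n : ℝ)) ^ 2 * ε n) ∧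
      (∑' n : ℕ, (1 + (n : ℝ)) ^ 2 * ε n) ≤ Atot * (1 + τ) ^ m ∧
      ∀ t : ℝ, |t| ≤ τ → ∀ n : ℕ,
        DependsOn (a ∘ severedFlow hB1 (Finset.Icc ((0 : ℤ) - n) ((0 : ℤ) + n)) t)
            (Icc (-(n : ℤ) - 1) (n + 1)) ∧
          Measurable (a ∘ severedFlow hB1 (Finset.Icc ((0 : ℤ) - n) ((0 : ℤ) + n)) t) ∧
          MemLp (a ∘ severedFlow hB1 (Finset.Icc ((0 : ℤ) - n) ((0 : ℤ) + n)) t) 2 μ ∧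
          Real.sqrt (∫ σ, (a (D.flow t σ) -
              a (severedFlow hB1 (Finset.Icc ((0 : ℤ) - n) ((0 : ℤ) + n)) t σ)) ^ 2 ∂μ) ≤ ε n := by
  haveI : IsProbabilityMeasure μ := hss.1
  have hU : ContDiff ℝ 2 P.U := hU1.contDiff_two
  have hV : ContDiff ℝ 2 P.V := hV1.contDiff_two
  have hUm : Measurable P.U := hU.continuous.measurable
  have hVm : Measurable P.V := hV.continuous.measurable
  -- the deterministic constants and the superstability constants (all chosen BEFORE the window `τ`)
  obtain ⟨A, K, L, hA1, hK0, hL0, hdet⟩ :=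
    D.exists_abs_sub_comp_severedFlow_le hs₁ hs₂ hU1 hV1 hcar hB1 ha
  obtain ⟨Cω, lam₀, hCω, hlam₀, hssb⟩ := hss.2
  obtain ⟨Kμ, hKμ, htail⟩ := P.measure_bmGrowthSet_gt_le hUm hVm hlam₀ (hssb lam₀ hlam₀ le_rfl)
  have hA0 : 0 ≤ A := zero_le_one.trans hA1
  obtain ⟨M₄, hM₄⟩ : ∃ M₄ : ℝ, M₄ = ∫ σ, a σ ^ 4 ∂μ := ⟨_, rfl⟩
  have hM₄0 : 0 ≤ M₄ := by rw [hM₄]; exact integral_nonneg fun _ => by positivity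
  obtain ⟨Cη, hCη⟩ : ∃ Cη : ℝ, Cη = Real.sqrt (2 * (M₄ + Kμ.toReal)) * Real.exp (Cω / 4) := ⟨_, rfl⟩
  have hCη0 : 0 ≤ Cη := by rw [hCη]; positivity
  obtain ⟨E₀, hE₀⟩ : ∃ E₀ : ℝ, E₀ = Real.sqrt (∫ σ, a σ ^ 2 ∂μ) + Real.sqrt (∫ σ, a σ ^ 2 ∂μ) := ⟨_, rfl⟩
  have hE₀0 : 0 ≤ E₀ := by rw [hE₀]; positivity
  obtain ⟨Cb₀, hCb₀⟩ : ∃ Cb₀ : ℝ, Cb₀ = 32 * Ca * (9 * L) ^ da := ⟨_, rfl⟩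
  have hCb₀0 : 0 ≤ Cb₀ := by rw [hCb₀]; positivity
  obtain ⟨Sp, hSp⟩ : ∃ Sp : ℝ, Sp = ∑' n : ℕ, (1 + (n : ℝ)) ^ 2 * ((n : ℝ) ^ (2 * da + 1) * ((1 : ℝ) / 32) ^ n) :=
    ⟨_, rfl⟩
  have hSp0 : 0 ≤ Sp := by rw [hSp]; exact tsum_nonneg fun n => by positivity
  obtain ⟨C₀, hC₀⟩ : ∃ C₀ : ℝ, C₀ = 13 + 4 * A + 2 * A * ((Cω + 3 / 2) / lam₀) + 2 * K := ⟨_, rfl⟩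
  have hCl0 : 0 ≤ (Cω + 3 / 2) / lam₀ := by positivity
  have hC₀0 : 0 ≤ C₀ := by rw [hC₀]; positivity
  refine ⟨E₀ * C₀ ^ 3 + Cb₀ * (2 + 22 * K) * Sp + 2 * Cη * (1 + 8 * A / lam₀) ^ 3, 9, fun τ hτ => ?_⟩
  -- the scale `c(τ)`
  obtain ⟨c, hc⟩ : ∃ c : ℝ, c = A * (1 + τ ^ 2 * (1 + τ)) := ⟨_, rfl⟩
  have hτ2 : 0 ≤ τ ^ 2 * (1 + τ) := by positivity
  have hAτc : A * (τ ^ 2 * (1 + τ)) ≤ c := by rw [hc, mul_add, mul_one]; linarith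
  have hAc : A ≤ c := by
    rw [hc]
    have : 0 ≤ A * (τ ^ 2 * (1 + τ)) := by positivity
    linarith
  have hc1 : 1 ≤ c := hA1.trans hAc
  have hc0 : 0 < c := one_pos.trans_le hc1
  have h1τ : (1 : ℝ) ≤ 1 + τ := by linarith
  have h1τ3 : (1 : ℝ) ≤ (1 + τ) ^ 3 := one_le_pow₀ h1τ
  have hcτ : c ≤ A * (1 + τ) ^ 3 := by rw [hc]; exact scale_le_cube hA0 hτ
  -- the EXPLICIT threshold `n₀(τ)`
  obtain ⟨X, hX⟩ : ∃ X : ℝ, X = 11 + 2 * A + 2 * c + 2 * c * ((Cω + 3 / 2) / lam₀) + 2 * τ * K := ⟨_, rfl⟩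
  have hX0 : 0 ≤ X := by rw [hX]; positivity
  set n₀ : ℕ := ⌈X⌉₊ with hn₀
  have hn₀X : X ≤ n₀ := Nat.le_ceil X
  have hn₀le : (n₀ : ℝ) ≤ X + 1 := (Nat.ceil_lt_add_one hX0).le
  -- the geometric ratio of the tail
  obtain ⟨ρ, hρ⟩ : ∃ ρ : ℝ, ρ = Real.exp (-(lam₀ / (8 * c))) := ⟨_, rfl⟩
  have hρ0 : 0 ≤ ρ := by rw [hρ]; exact Real.exp_nonneg _
  have hρ1 : ρ < 1 := by rw [hρ]; exact Real.exp_lt_one_iff.2 (by rw [neg_lt_zero]; positivity)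
  obtain ⟨Cb, hCb⟩ : ∃ Cb : ℝ, Cb = Cb₀ * (2 + 22 * τ * K) := ⟨_, rfl⟩
  have hCb0 : 0 ≤ Cb := by rw [hCb]; positivity
  have hbn0 : ∀ n : ℕ, 0 ≤ Cb * (n : ℝ) ^ (2 * da + 1) * ((1 : ℝ) / 32) ^ n := fun n => by positivity
  have hε0 : ∀ n : ℕ, 0 ≤ (if n < n₀ then E₀ else
      Cb * (n : ℝ) ^ (2 * da + 1) * ((1 : ℝ) / 32) ^ n + Cη * ρ ^ n) := fun n => by
    split_ifs
    · exact hE₀0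
    · exact add_nonneg (hbn0 n) (by positivity)
  -- summability and the polynomial bound on the weighted sum
  obtain ⟨hsum, hsumle⟩ := weighted_twoRegime_rate_tsum_le hE₀0 hCb0 hCη0 hρ0 hρ1 (2 * da + 1) n₀
  rw [← hSp] at hsumle
  have hpoly : E₀ * (1 + (n₀ : ℝ)) ^ 3 + Cb * Sp + 2 * Cη / (1 - ρ) ^ 3 ≤
      (E₀ * C₀ ^ 3 + Cb₀ * (2 + 22 * K) * Sp + 2 * Cη * (1 + 8 * A / lam₀) ^ 3) * (1 + τ) ^ 9 := by
    -- the threshold is cubic in the window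
    have hn0τ : 1 + (n₀ : ℝ) ≤ C₀ * (1 + τ) ^ 3 := by
      have h1 : 1 + (n₀ : ℝ) ≤ X + 2 := by linarith
      have h2 := threshold_le_cube hA0 hK0 hCl0 hτ hcτ
      have h3 : X + 2 = 13 + 2 * A + 2 * c + 2 * c * ((Cω + 3 / 2) / lam₀) + 2 * τ * K := by
        rw [hX]; ring
      rw [hC₀]
      linarith
    have hT1 : E₀ * (1 + (n₀ : ℝ)) ^ 3 ≤ E₀ * C₀ ^ 3 * (1 + τ) ^ 9 := by
      have h1 : (1 + (n₀ : ℝ)) ^ 3 ≤ (C₀ * (1 + τ) ^ 3) ^ 3 := pow_le_pow_left₀ (by positivity) hn0τ 3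
      calc E₀ * (1 + (n₀ : ℝ)) ^ 3 ≤ E₀ * (C₀ * (1 + τ) ^ 3) ^ 3 := mul_le_mul_of_nonneg_left h1 hE₀0
        _ = E₀ * C₀ ^ 3 * (1 + τ) ^ 9 := by ring
    have hT2 : Cb * Sp ≤ Cb₀ * (2 + 22 * K) * Sp * (1 + τ) ^ 9 := by
      have h1 : 2 + 22 * τ * K ≤ (2 + 22 * K) * (1 + τ) ^ 9 := lin_window_le_pow_nine hK0 hτ
      calc Cb * Sp = Cb₀ * (2 + 22 * τ * K) * Sp := by rw [hCb]
        _ ≤ Cb₀ * ((2 + 22 * K) * (1 + τ) ^ 9) * Sp := by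
            refine mul_le_mul_of_nonneg_right (mul_le_mul_of_nonneg_left h1 hCb₀0) hSp0
        _ = Cb₀ * (2 + 22 * K) * Sp * (1 + τ) ^ 9 := by ring
    have hT3 : 2 * Cη / (1 - ρ) ^ 3 ≤ 2 * Cη * (1 + 8 * A / lam₀) ^ 3 * (1 + τ) ^ 9 := by
      have hx : 0 < lam₀ / (8 * c) := by positivity
      have h1 := two_div_one_sub_exp_neg_cube_le hx
      rw [← hρ] at h1
      have h2 : 1 + 1 / (lam₀ / (8 * c)) = 1 + 8 * c / lam₀ := by field_simp
      rw [h2] at h1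
      have h3 : 1 + 8 * c / lam₀ ≤ (1 + 8 * A / lam₀) * (1 + τ) ^ 3 :=
        ratio_window_le_cube hA0 hlam₀ hτ hcτ
      have h4 : (1 + 8 * c / lam₀) ^ 3 ≤ ((1 + 8 * A / lam₀) * (1 + τ) ^ 3) ^ 3 :=
        pow_le_pow_left₀ (by positivity) h3 3
      have hρpos : 0 < (1 - ρ) ^ 3 := pow_pos (by linarith) 3
      calc 2 * Cη / (1 - ρ) ^ 3 = Cη * (2 / (1 - ρ) ^ 3) := by ring
        _ ≤ Cη * (2 * (1 + 8 * c / lam₀) ^ 3) := mul_le_mul_of_nonneg_left h1 hCη0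
        _ ≤ Cη * (2 * ((1 + 8 * A / lam₀) * (1 + τ) ^ 3) ^ 3) := by
            refine mul_le_mul_of_nonneg_left (mul_le_mul_of_nonneg_left h4 (by norm_num)) hCη0
        _ = 2 * Cη * (1 + 8 * A / lam₀) ^ 3 * (1 + τ) ^ 9 := by ring
    calc E₀ * (1 + (n₀ : ℝ)) ^ 3 + Cb * Sp + 2 * Cη / (1 - ρ) ^ 3
        ≤ E₀ * C₀ ^ 3 * (1 + τ) ^ 9 + Cb₀ * (2 + 22 * K) * Sp * (1 + τ) ^ 9 +
            2 * Cη * (1 + 8 * A / lam₀) ^ 3 * (1 + τ) ^ 9 := by linarith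
      _ = (E₀ * C₀ ^ 3 + Cb₀ * (2 + 22 * K) * Sp + 2 * Cη * (1 + 8 * A / lam₀) ^ 3) * (1 + τ) ^ 9 := by
          ring
  refine ⟨fun n => if n < n₀ then E₀ else Cb * (n : ℝ) ^ (2 * da + 1) * ((1 : ℝ) / 32) ^ n + Cη * ρ ^ n,
    hε0, hsum, hsumle.trans hpoly, fun t ht n => ?_⟩
  -- the approximant
  have hsev' := hsev n t
  have hgm : Measurable (a ∘ severedFlow hB1 (Finset.Icc ((0 : ℤ) - n) ((0 : ℤ) + n)) t) :=
    ham.comp (measurable_severedFlow hB1 _ hU hV t)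
  have hg2 : MemLp (a ∘ severedFlow hB1 (Finset.Icc ((0 : ℤ) - n) ((0 : ℤ) + n)) t) 2 μ :=
    ha2.comp_measurePreserving hsev'
  refine ⟨dependsOn_comp_severedFlow hU hV hB1 had n t, hgm, hg2, ?_⟩
  -- the trivial bound
  have hφ2 : MemLp (a ∘ D.flow t) 2 μ := ha2.comp_measurePreserving (hD.2 t)
  have htriv : Real.sqrt (∫ σ, (a (D.flow t σ) -
      a (severedFlow hB1 (Finset.Icc ((0 : ℤ) - n) ((0 : ℤ) + n)) t σ)) ^ 2 ∂μ) ≤ E₀ := by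
    have h := sqrt_integral_sub_sq_le hφ2 hg2
    simp only [comp_apply] at h
    rw [integral_sq_comp_eq' (hD.2 t) ham, integral_sq_comp_eq' hsev' ham] at h
    rw [hE₀]; exact h
  by_cases hsmall : n < n₀
  · simp only [if_pos hsmall]; exact htriv
  -- the main regime `n ≥ n₀`: the four threshold facts
  simp only [if_neg hsmall]
  have hn0 : n₀ ≤ n := not_lt.1 hsmall
  have hn0' : (n₀ : ℝ) ≤ n := by exact_mod_cast hn0
  have hnX : X ≤ n := hn₀X.trans hn0'
  have hcC : 0 ≤ 2 * c * ((Cω + 3 / 2) / lam₀) := by positivity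
  have hτK : 0 ≤ 2 * τ * K := by positivity
  have hth1 : 8 + 2 * A ≤ (n : ℝ) := by rw [hX] at hnX; linarith
  have hth2 : 2 * c ≤ (n : ℝ) := by rw [hX] at hnX; linarith
  have hth3 : 2 * c * (Cω + 3 / 2) / lam₀ ≤ (n : ℝ) := by
    rw [hX] at hnX
    rw [mul_div_assoc]
    linarith
  have hth4 : (3 : ℝ) ≤ n := by rw [hX] at hnX; linarith
  have hn3 : 3 ≤ n := by exact_mod_cast hth4
  have hth5 : 22 * τ * K ≤ 16 * (n : ℝ) := by
    rw [hX] at hnX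
    have h2 : 2 * τ * K ≤ (n : ℝ) := by linarith
    have h3 : (0 : ℝ) ≤ n := by linarith
    linarith
  have hn1 : (1 : ℝ) ≤ n := by linarith
  -- the level `N = n / (2c)` and its bounds
  obtain ⟨hN1, hNle, hC1⟩ := level_bounds (τ := τ) hc1 hAτc hth1 hth2
  obtain ⟨N, hN⟩ : ∃ N : ℝ, N = (n : ℝ) / (2 * c) := ⟨_, rfl⟩
  rw [← hN] at hN1 hNle hC1
  have hN0 : 0 ≤ N := zero_le_one.trans hN1
  have h2cN : 2 * c * N = n := by rw [hN]; field_simp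
  obtain ⟨hδle, hb_le⟩ := good_rate_le (da := da) hCa hL0 hK0 hτ hN0 hNle hn1
  have hdec : (2 + 22 * τ * K * n) * 32 * ((1 : ℝ) / 32) ^ n ≤ 1 := by
    have h := lightCone_threshold_decay_le_one (b := 22 * τ * K) hn3 hth5
    simpa only [mul_assoc] using h
  have hδ1 : (2 + 22 * τ * K * N) * ((1 : ℝ) / 32) ^ (n - 1) ≤ 1 := hδle.trans hdec
  obtain ⟨hN', hsqrtη⟩ := tail_exponent_bounds (Cω := Cω) hc0 hlam₀ h2cN hth3
  rw [← hρ] at hsqrtη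
  -- the bad event
  obtain ⟨B, hB⟩ : ∃ B : Set ChainConfig, B = {σ | ∃ r ∈ P.bmGrowthSet σ, N < r} ∪ (P.bmGood)ᶜ :=
    ⟨_, rfl⟩
  have hBm : MeasurableSet B := by
    rw [hB]
    exact (P.measurableSet_bmGrowthSet_gt hUm hVm N).union (P.measurableSet_bmGood hUm hVm).compl
  have hgood : ∀ σ, σ ∉ B → σ ∈ P.bmGood ∧ P.bmGrowth σ ≤ N := by
    intro σ hσ
    rw [hB] at hσ
    have h1 : σ ∈ P.bmGood := by
      by_contra h
      exact hσ (Or.inr h)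
    refine ⟨h1, csSup_le (bmGrowthSet_nonempty σ) fun r hr => ?_⟩
    by_contra h
    exact hσ (Or.inl ⟨r, hr, not_le.1 h⟩)
  -- pointwise bound off `B`
  have hb0 : 0 ≤ Ca * (L * N * (2 * n + 7)) ^ da * ((2 + 22 * τ * K * N) * ((1 : ℝ) / 32) ^ (n - 1)) := by
    positivity
  have hbound : ∀ σ, σ ∉ B → |a (D.flow t σ) -
      a (severedFlow hB1 (Finset.Icc ((0 : ℤ) - n) ((0 : ℤ) + n)) t σ)| ≤
      Ca * (L * N * (2 * n + 7)) ^ da * ((2 + 22 * τ * K * N) * ((1 : ℝ) / 32) ^ (n - 1)) := by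
    intro σ hσ
    obtain ⟨hσg, hQ⟩ := hgood σ hσ
    exact hdet N hN1 σ hσg hQ τ hτ n hC1 hδ1 t ht
  -- measure of the bad event
  have hBμ : μ.real B ≤ Kμ.toReal * Real.exp (-(lam₀ * N - Cω) / 2) ^ 2 := by
    have hη2 : Real.exp (-(lam₀ * N - Cω) / 2) ^ 2 = Real.exp (-(lam₀ * N - Cω)) := by
      rw [← Real.exp_nat_mul]; congr 1; push_cast; ring
    rw [hη2]
    have h1 : μ B ≤ μ {σ | ∃ r ∈ P.bmGrowthSet σ, N < r} + μ (P.bmGood)ᶜ := by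
      rw [hB]; exact measure_union_le _ _
    have h2 : μ (P.bmGood)ᶜ = 0 := by
      have h := hD.1
      rw [hcar, ae_iff] at h
      exact h
    rw [h2, add_zero] at h1
    have h4 : μ B ≤ ENNReal.ofReal (Real.exp (-(lam₀ * N - Cω))) * Kμ := h1.trans (htail N hN')
    calc μ.real B = (μ B).toReal := rfl
      _ ≤ (ENNReal.ofReal (Real.exp (-(lam₀ * N - Cω))) * Kμ).toReal :=
          ENNReal.toReal_mono (ENNReal.mul_ne_top ENNReal.ofReal_ne_top hKμ) h4
      _ = Kμ.toReal * Real.exp (-(lam₀ * N - Cω)) := by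
          rw [ENNReal.toReal_mul, ENNReal.toReal_ofReal (Real.exp_nonneg _), mul_comm]
  -- the splitting with `θ = η := e^{-(λ₀ N - C_ω)/2}`
  have hη0 : 0 < Real.exp (-(lam₀ * N - Cω) / 2) := Real.exp_pos _
  have hf4 : Integrable (fun σ => a (D.flow t σ) ^ 4) μ := (hD.2 t).integrable_comp_of_integrable ha4
  have hg4 : Integrable (fun σ => a (severedFlow hB1 (Finset.Icc ((0 : ℤ) - n) ((0 : ℤ) + n)) t σ) ^ 4) μ :=
    hsev'.integrable_comp_of_integrable ha4
  obtain ⟨-, hsplit⟩ := integral_sub_sq_le_of_bound_off (f := fun σ => a (D.flow t σ))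
    (g := fun σ => a (severedFlow hB1 (Finset.Icc ((0 : ℤ) - n) ((0 : ℤ) + n)) t σ))
    (ham.comp (hD.2 t).measurable) (ham.comp (measurable_severedFlow hB1 _ hU hV t)) hf4 hg4 hBm hη0
    hbound
  have hI1 : ∫ σ, a (D.flow t σ) ^ 4 ∂μ = M₄ := by rw [hM₄]; exact integral_pow_four_comp_eq (hD.2 t) ham
  have hI2 : ∫ σ, a (severedFlow hB1 (Finset.Icc ((0 : ℤ) - n) ((0 : ℤ) + n)) t σ) ^ 4 ∂μ = M₄ := by
    rw [hM₄]; exact integral_pow_four_comp_eq hsev' ham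
  rw [hI1, hI2, probReal_univ, mul_one] at hsplit
  have hfin := sqrt_le_of_split hb0 hb_le hη0 hM₄0 ENNReal.toReal_nonneg hBμ hsplit
  have hCbeq : 32 * Ca * (9 * L) ^ da * (2 + 22 * τ * K) = Cb := by rw [hCb, hCb₀]
  rw [hCbeq] at hfin
  refine hfin.trans ?_
  have h1 : Real.sqrt (2 * (M₄ + Kμ.toReal)) * Real.sqrt (Real.exp (-(lam₀ * N - Cω) / 2)) ≤ Cη * ρ ^ n := by
    calc Real.sqrt (2 * (M₄ + Kμ.toReal)) * Real.sqrt (Real.exp (-(lam₀ * N - Cω) / 2))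
        ≤ Real.sqrt (2 * (M₄ + Kμ.toReal)) * (Real.exp (Cω / 4) * ρ ^ n) :=
          mul_le_mul_of_nonneg_left hsqrtη (Real.sqrt_nonneg _)
      _ = Cη * ρ ^ n := by rw [hCη]; ring
  linarith

end InfiniteChainDynamics

end Literature.MathematicalPhysics.KineticTheory.HeatConduction

end
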